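import Literature.Geometry.Riemannian.EigenvaluePinchingSphereGramProofs
import HarnessLib

/-!
# Eigenvalue pinching `λₙ ≤ n + ε ⇒ M ≅ Sⁿ` (Aubry 2005, Théorème 1): decomposition of the named
# fact along the printed proof (fact-decompose, 2026-08-16)

E. Aubry, *Pincement sur le spectre et le volume en courbure de Ricci positive*, Ann. Sci. ÉNS
(4) 38 (2005) 387–405. The named fact
`Literature.Geometry.Riemannian.aubry_diffeomorph_sphere_of_eigenvalue_pinching`
(`EigenvaluePinchingSphere.lean`, Théorème 1) is assembled in print (p. 402: "la proposition
suivante [Prop. 19] … combinée à la proposition 12 et au théorème de J. Cheeger et T. Colding …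
démontre le théorème 1") from three inputs, and that assembly is PROVED in the tree
(`aubry_diffeomorph_sphere_of_eigenvalue_pinching_of_prop12_prop19`,
`EigenvaluePinchingSphereGramProofs.lean`, Part K), with the two Aubry propositions written out
as hypotheses (D-0026). The proving seat hit the budget cap there; this file turns the two
hypotheses into named facts and records the assembly:

* `Aubry2005_prop12` — **Proposition 12** (p. 395; with the Remarque after Prop. 19, p. 402) in
  qualitative eigenfunction form: `λₙ₊₁(M) ≤ n + ε(n, δ)` under `Ric ≥ n − 1` forces
  `Vol M ≥ (1 − δ) Vol Sⁿ` (child);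
* `Aubry2005_prop19` — **Proposition 19** (p. 402) in qualitative eigenfunction form:
  `λₙ(M) ≤ n + ε(n, ε')` under `Ric ≥ n − 1` forces `λₙ₊₁(M) ≤ n + ε'` (child);
* `aubry_diffeomorph_sphere_of_eigenvalue_pinching_holds_of` — **the assembly**
  `CheegerColding1997_thmA110 → Aubry2005_prop12 → Aubry2005_prop19 → Théorème 1` (proved),
  Cheeger–Colding's differentiable volume sphere theorem being the tree's existing named fact
  `CheegerColding1997_thmA110` (`VolumeSphereTheorem.lean`).

Both children are statements about different quantities than the parent (volume, resp. the
`(n+1)`-st eigenvalue, instead of the diffeomorphism type) and are the two propositions of the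
source; the bricks already proved towards them are listed in the module docstrings of
`EigenvaluePinchingSphereProofs.lean` (Parts A–B: Bochner, Lichnerowicz, Aubry's `L²`-estimate),
`EigenvaluePinchingSphereMoserProofs.lean` (Parts C–D: Lemme 11) and
`EigenvaluePinchingSphereGramProofs.lean` (Parts E–J: Lemmes 13–15, Gram determinants). "In
qualitative form": the printed explicit rates `C(n) ε^{1/(2(n+1))}`, `C(n) ε^{1/2}` are replaced
by `∀ δ ∃ ε`, which is all the assembly uses and is implied by the printed statements.

## References

* [Aubry2005] E. Aubry, Ann. Sci. École Norm. Sup. (4) 38 (2005) 387–405: Théorème 1 (p. 388),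
  Proposition 12 (p. 395), Proposition 19 and Remarque (p. 402).
* [CheegerColding1997] J. Cheeger, T. H. Colding, J. Differential Geom. 46 (1997), App. 1,
  Thm. A.1.10.
-/

noncomputable section

open MeasureTheory
open scoped Manifold ContDiff

namespace Literature.Geometry.Riemannian

open Literature.Geometry.Lorentzian (PseudoRiemannianMetric riemannianMeasure)
open Literature.Geometry.Lorentzian.PseudoRiemannianMetric

/-- **Aubry 2005, Proposition 12** (p. 395: "il existe `C(n)` telle que si `λₙ₊₁(M) ≤ n + ε`
alors `Vol M ≥ (1 − C(n) ε^{1/(2(n+1))}) Vol Sⁿ`", for `(Mⁿ, g)` complete with `Ric ≥ n − 1`;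
cf. the Remarque after Prop. 19, p. 402), in the qualitative eigenfunction form consumed by the
assembly of Théorème 1 (named fact): for every `n ≥ 2` and `δ > 0` there is `ε > 0` such that a
closed connected Riemannian `n`-manifold with `Ric_g ≥ (n − 1) g` carrying `n + 1` smooth
`L²(dv_g)`-orthonormal Laplace eigenfunctions `tr_g Hess fᵢ = −μᵢ fᵢ` with `0 < μᵢ ≤ n + ε`
(i.e. `λₙ₊₁(M, g) ≤ n + ε` by min–max) has `Vol(M, g) ≥ (1 − δ) Vol Sⁿ`
(`|Sⁿ| = unitSphereVolume n`). Printed proof: Lemmes 13–15 (the eigenmap `Φ = f/|f| : M → Sⁿ`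
is a Hausdorff approximation of degree `±1`), Bishop–Gromov, the area formula and the
orientation cover (§3, pp. 395–398).
[cite: Aubry2005, Proposition 12 (p. 395) with the Remarque after Proposition 19 (p. 402)] -/
def Aubry2005_prop12 : Prop :=
  ∀ (n : ℕ), 2 ≤ n → ∀ δ : ℝ, 0 < δ → ∃ ε : ℝ, 0 < ε ∧
    ∀ (M : Type) [TopologicalSpace M] [T2Space M] [SecondCountableTopology M]
      [ChartedSpace (EuclideanSpace ℝ (Fin n)) M] [IsManifold (𝓡 n) ∞ M] [CompactSpace M]
      [ConnectedSpace M] [T3Space M] [MeasurableSpace M] [BorelSpace M]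
      (g : Bundle.ContMDiffRiemannianMetric (𝓡 n) ∞ (EuclideanSpace ℝ (Fin n))
        (TangentSpace (𝓡 n) : M → Type _))
      (_ : (ofRiemannian g).HasLeviCivita) (f : Fin (n + 1) → M → ℝ) (μ : Fin (n + 1) → ℝ),
      (∀ (x : M) (v : TangentSpace (𝓡 n) x),
          ((n : ℝ) - 1) * g.inner x v v ≤ (ofRiemannian g).ricci x v v) →
      (∀ i, ContMDiff (𝓡 n) 𝓘(ℝ, ℝ) ∞ (f i)) →
      (∀ (i : Fin (n + 1)) (x : M), (ofRiemannian g).dalembertian (f i) x = -(μ i) * f i x) →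
      (∀ i, 0 < μ i ∧ μ i ≤ n + ε) →
      (∀ i j, ∫ x, f i x * f j x ∂(riemannianMeasure g) = if i = j then 1 else 0) →
      ENNReal.ofReal ((1 - δ) * unitSphereVolume n) ≤ riemannianMeasure g Set.univ

/-- **Aubry 2005, Proposition 19** (p. 402: "il existe `C(n) > 0` tel que toute variété
complète `(Mⁿ, g)` vérifiant `Ric ≥ n − 1` et `λₙ(M) ≤ n + ε` vérifie `λₙ₊₁(M) ≤ n + C(n) ε^{1/2}`"),
in the qualitative eigenfunction form consumed by the assembly of Théorème 1 (named fact): for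
every `n ≥ 2` and `ε' > 0` there is `ε > 0` such that on a closed connected Riemannian
`n`-manifold with `Ric_g ≥ (n − 1) g`, `n` smooth `L²(dv_g)`-orthonormal Laplace eigenfunctions
`tr_g Hess fᵢ = −μᵢ fᵢ` with `0 < μᵢ ≤ n + ε` (i.e. `λₙ ≤ n + ε`) force the existence of `n + 1`
smooth `L²`-orthonormal eigenfunctions with eigenvalues `0 < μ'ᵢ ≤ n + ε'` (i.e. `λₙ₊₁ ≤ n + ε'`).
Printed proof: Lemme 18 (the section `S_{n+1}` of Ruh's bundle built from `S₁, …, Sₙ` is almost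
parallel), the Moser-iteration estimates of §2 with Ilias' Sobolev inequality, min–max, and in
the non-orientable case Lemmes 16–17 (§6, pp. 400–402).
[cite: Aubry2005, Proposition 19 (p. 402)] -/
def Aubry2005_prop19 : Prop :=
  ∀ (n : ℕ), 2 ≤ n → ∀ ε' : ℝ, 0 < ε' → ∃ ε : ℝ, 0 < ε ∧
    ∀ (M : Type) [TopologicalSpace M] [T2Space M] [SecondCountableTopology M]
      [ChartedSpace (EuclideanSpace ℝ (Fin n)) M] [IsManifold (𝓡 n) ∞ M] [CompactSpace M]
      [ConnectedSpace M] [T3Space M] [MeasurableSpace M] [BorelSpace M]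
      (g : Bundle.ContMDiffRiemannianMetric (𝓡 n) ∞ (EuclideanSpace ℝ (Fin n))
        (TangentSpace (𝓡 n) : M → Type _))
      (_ : (ofRiemannian g).HasLeviCivita) (f : Fin n → M → ℝ) (μ : Fin n → ℝ),
      (∀ (x : M) (v : TangentSpace (𝓡 n) x),
          ((n : ℝ) - 1) * g.inner x v v ≤ (ofRiemannian g).ricci x v v) →
      (∀ i, ContMDiff (𝓡 n) 𝓘(ℝ, ℝ) ∞ (f i)) →
      (∀ (i : Fin n) (x : M), (ofRiemannian g).dalembertian (f i) x = -(μ i) * f i x) →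
      (∀ i, 0 < μ i ∧ μ i ≤ n + ε) →
      (∀ i j, ∫ x, f i x * f j x ∂(riemannianMeasure g) = if i = j then 1 else 0) →
      ∃ (f' : Fin (n + 1) → M → ℝ) (μ' : Fin (n + 1) → ℝ),
        (∀ i, ContMDiff (𝓡 n) 𝓘(ℝ, ℝ) ∞ (f' i)) ∧
        (∀ (i : Fin (n + 1)) (x : M), (ofRiemannian g).dalembertian (f' i) x = -(μ' i) * f' i x) ∧
        (∀ i, 0 < μ' i ∧ μ' i ≤ n + ε') ∧
        (∀ i j, ∫ x, f' i x * f' j x ∂(riemannianMeasure g) = if i = j then 1 else 0)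

/-- **Assembly of Aubry 2005, Théorème 1** (p. 402): the named fact
`aubry_diffeomorph_sphere_of_eigenvalue_pinching` follows from Cheeger–Colding's volume sphere
theorem (`CheegerColding1997_thmA110`, existing named fact), Proposition 12 (`Aubry2005_prop12`)
and Proposition 19 (`Aubry2005_prop19`) — the tree's theorem
`aubry_diffeomorph_sphere_of_eigenvalue_pinching_of_prop12_prop19`. The discharge
`aubry_diffeomorph_sphere_of_eigenvalue_pinching_holds` is this theorem applied to the three
`…_holds` once they land.
[cite: Aubry2005, Théorème 1 (p. 388) via Prop. 12 (p. 395), Prop. 19 (p. 402)]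
[cite: CheegerColding1997, Thm. A.1.10] -/
theorem aubry_diffeomorph_sphere_of_eigenvalue_pinching_holds_of
    (hCC : CheegerColding1997_thmA110) (h12 : Aubry2005_prop12) (h19 : Aubry2005_prop19) :
    aubry_diffeomorph_sphere_of_eigenvalue_pinching :=
  aubry_diffeomorph_sphere_of_eigenvalue_pinching_of_prop12_prop19 hCC h12 h19

end Literature.Geometry.Riemannian

end
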